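import Summits.QuantumFields.BalabanUV.Beta.GAN24.PairingCellTransfer
import Summits.QuantumFields.BalabanUV.Beta.SpineRecursivePureParity

/-!
# `BalabanUV.Beta.GAN24.ContactPairingCellTransfer` — binder row G-an2-4 ∕ (CONV-C), row (C) at the levels `j ≥ 1`, CONTACT side; Part 43 of
# `GAN24/FourFaceGaugeSectors`: **BOTH CONTACT SUMMANDS OF PART 40's MEMBER ZERO MODE ARE EXIT-FACE PAIRINGS OF A TRIPLE WORD, AND THEIR CELL RESTRICTION
# SITS ON EITHER CURRENT** — with `S_j = SpureRecAt … j`, `G_j = coDressKBmAt ρ Lc (KInvStep Lc j)`, `cH_j = (stepScale_j·Lc^{d+1})⁻¹` and the pairings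
# `Ψ(v,t) := 𝟙[v_κ≡−1]·𝟙[t_κ′≡−1]·Σ'_{(y,w)} 𝟙[y_α≡−1]𝟙[w_β≡−1]·(S_j κ v ∘ G_j ∘ S_j κ′ t)(y,w)(inl α, inl β)` and
# `Ψ′(v,t) := 𝟙[v_κ≡−1]·𝟙[t_κ′≡−1]·Σ'_{(y,w)} 𝟙[y_α≡−1]𝟙[w_β≡−1]·(S_j κ′ t ∘ (G_j ∘ S_j κ v))(y,w)(inl α, inl β)`:
# first summand (`QuarticMemberTwoLevel.zmode_T2RecAt_succ_twoLevel(′)` :63–:67, VERBATIM) `= cH_j²·Σ_{rr∈box} Σ'_t Ψ(toSite rr, t) = cH_j²·Σ_{rr∈box} Σ'_v Ψ(v, toSite rr)`,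
# second summand (:68–:72, VERBATIM) `= cH_j²·Σ_{rr∈box} Σ'_t Ψ′(toSite rr, t) = cH_j²·Σ_{rr∈box} Σ'_v Ψ′(v, toSite rr)` (every `j`, in-block root, `1 ≤ Lc`, ANY colour constants)

NOT IN PRINT; OUR BOOKKEEPING (G-an2-4 crux team (2), leaf prover `b2b-balaban-gan24-formalise-leaf-02`, gen 68).  WHY (memo `CT-THREE-CHANNELS-g68.md` §3c; Part 42's
docstring): road-P2's pair-form socket (F9 `exists_pairForm_of_word`) needs each of the two currents of a contact pairing to be read as the FULL (Ward-antisymmetric,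
leaf-06's lane) one in turn; the cell-restricted current is not antisymmetric on the diagonal, so the cell restriction of `zmode`'s first slot must be movable
between the two currents — this file proves it IS, for the literal typed objects and at Part 40's literal brackets.  [folklore] BY NAME: an2's
`decays_locStencil_common` ∕ `SpureRecAt_translate` ∕ `shiftK_coDressKBmAt_KInvStep`, the kernel calculus `biLoc_comp_right` ∕ `biLoc_comp_decays` ∕ `biLoc_comp_biLoc` ∕
`comp_shiftK` ∕ `trK_comp`, Part 42's generic kinematics (`sum_box_tsum_swap_of_cov`, `abs_tsum_facePair_le`, `tsum_facePair_shiftK`, `nested_eq_facePairing`); 0 `def`,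
0 cited facts, 0 `def … : Prop`, 0 sorry.
* §1 `biLoc_tripleWord` (bi-localised at `(v, t)`, rate `δ/2`, constant `K·e^{−(δ/4)|v−t|₁}`), `tripleWord_translate` (jointly block-covariant).
* §2 **`sum_box_tsum_facePairing_swap`**: `Σ_{rr∈box} Σ'_t Ψ(toSite rr, t) = Σ_{rr∈box} Σ'_v Ψ(v, toSite rr)`.
* §3 **`contactA_eq_facePairing`**, **`contactA_eq_facePairing_swap`** — the first summand, literal, in both cell placements (Part 42's bridge per first bond).
* §4 `locStencil_trK`, **`nested_eq_facePairing_snd`** (the bridge for the second word = Part 42's bridge on the TRANSPOSED data `trK (S κ u)`, `trK G`, legs `β, α`,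
  read back by `trK_comp`), **`contactB_eq_facePairing`** — the second summand, literal.
* §5 `biLoc_tripleWord_snd`, `tripleWord_snd_translate`, **`sum_box_tsum_facePairing_snd_swap`**, **`contactB_eq_facePairing_swap`** — its cell on either current.
HONEST: kinematics; NO current, pairing or table valued; the currents' antisymmetry (Ward; leaf-06's lane) NOT touched; NOTHING of (C) at j ≥ 1 ∕ `hPair` ∕ `hSrc` ∕
(Q-L) discharged; NEVER «G-an2-4 closed» as (CONV-C); NOT D1, NOT `BetaPertH`, NOT continuum, NOT Clay.  HONEST DEPENDENCY: continuum YM on T⁴ ⇐ BetaPertH ∧ nine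
spine estimates (0/9 proved); BetaPertH ⇐ (D1) ∧ (D4) ∧ CAP+tail; G-an2-4 gates asym, D1 and NE2/3/4.  2026-08-24; no existing file touched.
-/

noncomputable section

open Finset
open scoped BigOperators
open Literature.MathematicalPhysics.QuantumFieldTheory
open Literature.MathematicalPhysics.QuantumFieldTheory.Balaban1983to89
open Literature.MathematicalPhysics.QuantumFieldTheory.Balaban1983to89.Beta
open B12Sec2to5 (l1 l1_nonneg)
open ExpKernelCalculus (Site MKer Decays BiLoc shiftK comp comp_shiftK Zl Zl_pos summable_exp_shift summable_exp_shift' tsum_exp_shift'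
  biLoc_comp_biLoc biLoc_comp_decays)
open OneStepResolventKernel (Fib LocStencil decays_mono biLoc_mono)
open AffineAveraging (box toSite)
open OneStepKernelFamily (KInvStep)
open BalabanStepJetsSucc (biLoc_comp_right)
open Summit.QuantumFields.BalabanUV.Beta.TameKernelCalculus (trK trK_apply trK_comp decays_trK biLoc_trK)
open Summit.QuantumFields.BalabanUV.Beta.AxialDressingRooted (coDressKBmAt decays_coDressKBmAt_KInvStep shiftK_coDressKBmAt_KInvStep)
open Summit.QuantumFields.BalabanUV.Beta.BorderedHessian (stepScale)
open Summit.QuantumFields.BalabanUV.Beta.SpineRooted (SpureRecAt locStencil_SpureRecAt SpureRecAt_translate)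
open Summit.QuantumFields.BalabanUV.Beta.SpineRecursivePureParity (decays_locStencil_common)
open Summit.QuantumFields.BalabanUV.Beta.GAN24.PairingCellTransfer (sum_box_tsum_swap_of_cov faceMask_add_zsmul abs_faceMask_le abs_tsum_facePair_le
  tsum_facePair_shiftK sum_ite_const_eq_mask_mul nested_eq_facePairing)

namespace Summit.QuantumFields.BalabanUV.Beta.GAN24.ContactPairingCellTransfer

variable {d : ℕ}
/-! ## §1 The triple word `S κ v ∘ G ∘ S κ′ s`: bi-localisation with the inner-distance factor, joint block covariance -/

section TripleWord

variable {S : Fin (d + 1) → Site (d + 1) → MKer (d + 1) (Fib d)} {G : MKer (d + 1) (Fib d)} {Cs CG δ : ℝ}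

/-- [folklore] **THE TRIPLE WORD IS BI-LOCALISED AT ITS TWO BONDS, SMALL IN THEIR DISTANCE**: for a local stencil family `S` (rate `δ`) and a decaying
kernel `G` (rate `δ`), `S κ v ∘ G ∘ S κ′ s` is `BiLoc` at `(v, s)` at rate `δ/2` with constant `K·e^{−(δ/4)|v−s|₁}`, `K` uniform in the bonds
(`biLoc_comp_right` then `biLoc_comp_biLoc`). -/
theorem biLoc_tripleWord (hS : LocStencil S Cs δ) (hG : Decays G CG δ) (hδ : 0 < δ) (κ κ' : Fin (d + 1)) (v s : Site (d + 1)) :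
    BiLoc (comp (comp (S κ v) G) (S κ' s)) v s
      ((Fintype.card (Fib d) : ℝ) * ((Fintype.card (Fib d) : ℝ) * (Cs * CG) * Zl (d + 1) (δ - δ / 2) * Cs) * Zl (d + 1) (δ / 2 / 2)
        * Real.exp (-(δ / 2 / 2) * l1 (v - s))) (δ / 2) := by
  have hCs : 0 ≤ Cs := (hS κ v).nonneg (Sum.inl 0)
  have h1 : BiLoc (comp (S κ v) G) v v ((Fintype.card (Fib d) : ℝ) * (Cs * CG) * Zl (d + 1) (δ - δ / 2)) (δ / 2) :=
    biLoc_comp_right (hS κ v) hG (by positivity) (by linarith)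
  have h2 : BiLoc (S κ' s) s s Cs (δ / 2) := biLoc_mono (hS κ' s) hCs (by linarith)
  exact biLoc_comp_biLoc h1 h2 (by positivity)

/-- [folklore] **JOINT BLOCK COVARIANCE OF THE TRIPLE WORD**: if `S κ (u + N•t) = shiftK (−N•t) (S κ u)` and `shiftK (−N•t) G = G`, then
`S κ (v+N•t) ∘ G ∘ S κ′ (s+N•t) = shiftK (−N•t) (S κ v ∘ G ∘ S κ′ s)` (`comp_shiftK` twice). -/
theorem tripleWord_translate {N : ℕ} (hSt : ∀ κ u t, S κ (u + (N : ℤ) • t) = shiftK (-((N : ℤ) • t)) (S κ u))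
    (hGt : ∀ t, shiftK (-((N : ℤ) • t)) G = G) (κ κ' : Fin (d + 1)) (v s t : Site (d + 1)) :
    comp (comp (S κ (v + (N : ℤ) • t)) G) (S κ' (s + (N : ℤ) • t)) = shiftK (-((N : ℤ) • t)) (comp (comp (S κ v) G) (S κ' s)) := by
  rw [hSt κ v t, hSt κ' s t]
  conv_lhs => rw [← hGt t]
  rw [comp_shiftK, comp_shiftK]

end TripleWord

/-! ## §2 The cell restriction of the face pairing moves between the two currents -/

section Literal

variable {Lc : ℕ} [NeZero Lc] {r : Fin (d + 1) → ℕ}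

/-- NOT IN PRINT; OUR BOOKKEEPING.  **THE CONTACT FACE PAIRING: THE CELL RESTRICTION SITS ON EITHER CURRENT** (every `j`, in-block root `r ∈ box`, `1 ≤ Lc`,
ANY colour constants, all directions `κ κ′ α β`).  With `W_j(v,s) := S_j κ v ∘ G_j ∘ S_j κ′ s` and the exit-face pairing
`Ψ(v,s) := 𝟙[v_κ ≡ −1]·𝟙[s_κ′ ≡ −1]·Σ'_{(y,w)} 𝟙[y_α ≡ −1]·𝟙[w_β ≡ −1]·W_j(v,s) y w (inl α)(inl β)`:
`Σ_{rr ∈ box Lc} Σ'_s Ψ(toSite rr, s) = Σ_{rr ∈ box Lc} Σ'_v Ψ(v, toSite rr)` — Part 42's `sum_box_tsum_swap_of_cov` on `Ψ`, which is jointly block-covariant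
(§2 + `tsum_facePair_shiftK`) and summable in each bond separately (§1–§2: `|Ψ(v,s)| ≤ K·Zl²·e^{−(δ/4)|v−s|₁}`). -/
theorem sum_box_tsum_facePairing_swap (hLc : 1 ≤ Lc) (hr : r ∈ box (d + 1) Lc) (cE cVH cΛ : ℝ) (j : ℕ) (κ κ' α β : Fin (d + 1)) :
    ∑ rr ∈ box (d + 1) Lc, ∑' s : Site (d + 1),
        (if toSite rr κ % (Lc : ℤ) = (Lc : ℤ) - 1 then (1 : ℝ) else 0) * (if s κ' % (Lc : ℤ) = (Lc : ℤ) - 1 then (1 : ℝ) else 0) *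
          ∑' yw : Site (d + 1) × Site (d + 1), (if yw.1 α % (Lc : ℤ) = (Lc : ℤ) - 1 then (1 : ℝ) else 0) * (if yw.2 β % (Lc : ℤ) = (Lc : ℤ) - 1 then (1 : ℝ) else 0) *
            comp (comp (SpureRecAt d Lc (toSite r) cE cVH cΛ j κ (toSite rr)) (coDressKBmAt (toSite r) Lc (KInvStep (d := d) Lc j)))
              (SpureRecAt d Lc (toSite r) cE cVH cΛ j κ' s) yw.1 yw.2 (Sum.inl α) (Sum.inl β)
      = ∑ rr ∈ box (d + 1) Lc, ∑' v : Site (d + 1),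
        (if v κ % (Lc : ℤ) = (Lc : ℤ) - 1 then (1 : ℝ) else 0) * (if toSite rr κ' % (Lc : ℤ) = (Lc : ℤ) - 1 then (1 : ℝ) else 0) *
          ∑' yw : Site (d + 1) × Site (d + 1), (if yw.1 α % (Lc : ℤ) = (Lc : ℤ) - 1 then (1 : ℝ) else 0) * (if yw.2 β % (Lc : ℤ) = (Lc : ℤ) - 1 then (1 : ℝ) else 0) *
            comp (comp (SpureRecAt d Lc (toSite r) cE cVH cΛ j κ v) (coDressKBmAt (toSite r) Lc (KInvStep (d := d) Lc j)))
              (SpureRecAt d Lc (toSite r) cE cVH cΛ j κ' (toSite rr)) yw.1 yw.2 (Sum.inl α) (Sum.inl β) := by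
  obtain ⟨δ, CG, Cs, hδ, hCG, hG, hS⟩ := decays_locStencil_common (d := d) hLc hr cE cVH cΛ j
  -- the pairing as a bi-sequence of the two bonds
  set Ψ : Site (d + 1) → Site (d + 1) → ℝ := fun v s =>
    (if v κ % (Lc : ℤ) = (Lc : ℤ) - 1 then (1 : ℝ) else 0) * (if s κ' % (Lc : ℤ) = (Lc : ℤ) - 1 then (1 : ℝ) else 0) *
      ∑' yw : Site (d + 1) × Site (d + 1), (if yw.1 α % (Lc : ℤ) = (Lc : ℤ) - 1 then (1 : ℝ) else 0) * (if yw.2 β % (Lc : ℤ) = (Lc : ℤ) - 1 then (1 : ℝ) else 0) *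
        comp (comp (SpureRecAt d Lc (toSite r) cE cVH cΛ j κ v) (coDressKBmAt (toSite r) Lc (KInvStep (d := d) Lc j)))
          (SpureRecAt d Lc (toSite r) cE cVH cΛ j κ' s) yw.1 yw.2 (Sum.inl α) (Sum.inl β) with hΨ
  -- uniform bound with the inner-distance factor
  set K₀ : ℝ := (Fintype.card (Fib d) : ℝ) * ((Fintype.card (Fib d) : ℝ) * (Cs * CG) * Zl (d + 1) (δ - δ / 2) * Cs) * Zl (d + 1) (δ / 2 / 2) with hK₀
  have hbound : ∀ v s, |Ψ v s| ≤ K₀ * (Zl (d + 1) (δ / 2) * Zl (d + 1) (δ / 2)) * Real.exp (-(δ / 2 / 2) * l1 (v - s)) := by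
    intro v s
    have hW := biLoc_tripleWord hS hG hδ κ κ' v s
    have h := abs_tsum_facePair_le hW (by positivity) (Lc : ℤ) α β (Sum.inl α) (Sum.inl β)
    have h0 : 0 ≤ K₀ * Real.exp (-(δ / 2 / 2) * l1 (v - s)) * (Zl (d + 1) (δ / 2) * Zl (d + 1) (δ / 2)) := (abs_nonneg _).trans h
    simp only [hΨ]
    rw [abs_mul, abs_mul]
    calc |(if v κ % (Lc : ℤ) = (Lc : ℤ) - 1 then (1 : ℝ) else 0)| * |(if s κ' % (Lc : ℤ) = (Lc : ℤ) - 1 then (1 : ℝ) else 0)| * _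
        ≤ 1 * 1 * (K₀ * Real.exp (-(δ / 2 / 2) * l1 (v - s)) * (Zl (d + 1) (δ / 2) * Zl (d + 1) (δ / 2))) :=
          mul_le_mul (mul_le_mul (abs_faceMask_le _ v κ) (abs_faceMask_le _ s κ') (abs_nonneg _) zero_le_one) h (abs_nonneg _) (by norm_num)
      _ = K₀ * (Zl (d + 1) (δ / 2) * Zl (d + 1) (δ / 2)) * Real.exp (-(δ / 2 / 2) * l1 (v - s)) := by ring
  have hδ4 : 0 < δ / 2 / 2 := by positivity
  have hGs : ∀ v, Summable fun s => Ψ v s := fun v =>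
    Summable.of_norm_bounded ((summable_exp_shift hδ4 v).mul_left (K₀ * (Zl (d + 1) (δ / 2) * Zl (d + 1) (δ / 2))))
      (fun s => by rw [Real.norm_eq_abs]; exact hbound v s)
  have hGv : ∀ s, Summable fun v => Ψ v s := fun s =>
    Summable.of_norm_bounded ((summable_exp_shift' hδ4 s).mul_left (K₀ * (Zl (d + 1) (δ / 2) * Zl (d + 1) (δ / 2))))
      (fun v => by rw [Real.norm_eq_abs]; exact hbound v s)
  -- joint block covariance
  have hGcov : ∀ v s t : Site (d + 1), Ψ (v + (Lc : ℤ) • t) (s + (Lc : ℤ) • t) = Ψ v s := by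
    intro v s t
    simp only [hΨ]
    rw [faceMask_add_zsmul Lc v t κ, faceMask_add_zsmul Lc s t κ',
      tripleWord_translate (S := SpureRecAt d Lc (toSite r) cE cVH cΛ j) (G := coDressKBmAt (toSite r) Lc (KInvStep (d := d) Lc j))
        (fun κ u t => SpureRecAt_translate (toSite r) hLc cE cVH cΛ j κ u t) (fun t => shiftK_coDressKBmAt_KInvStep (d := d) (toSite r) j t)
        κ κ' v s t,
      tsum_facePair_shiftK Lc _ t α β (Sum.inl α) (Sum.inl β)]
  exact (sum_box_tsum_swap_of_cov (N := Lc) hGs hGv hGcov).symm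

end Literal

/-! ## §3 At the wall: Part 40's first contact summand in the face-pairing currency, with the cell on either current -/

section WallBridge

variable {Lc : ℕ} [NeZero Lc] {r : Fin (d + 1) → ℕ}

/-- NOT IN PRINT; OUR BOOKKEEPING.  **PART 40's FIRST CONTACT SUMMAND IS `cH_j²·Σ_{rr∈box} Σ'_t Ψ(toSite rr, t)`** (the literal bracket of
`QuarticMemberTwoLevel.zmode_T2RecAt_succ_twoLevel(′)` :63–:67 ∕ Part 38, cell restriction on the `κ`-current as displayed there; every `j`, in-block root,
`1 ≤ Lc`, ANY colour constants). -/
theorem contactA_eq_facePairing (hLc : 1 ≤ Lc) (hr : r ∈ box (d + 1) Lc) (cE cVH cΛ : ℝ) (j : ℕ) (κ κ' α β : Fin (d + 1)) :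
    ∑ f : Fib d, (stepScale d Lc j * (Lc : ℝ) ^ (d + 1))⁻¹ * ∑ rr ∈ box (d + 1) Lc, (if toSite rr κ % (Lc : ℤ) = (Lc : ℤ) - 1 then
        ∑' yz : Site (d + 1) × Site (d + 1), (if yz.1 α % (Lc : ℤ) = (Lc : ℤ) - 1 then (1 : ℝ) else 0) *
          comp (SpureRecAt d Lc (toSite r) cE cVH cΛ j κ (toSite rr)) (coDressKBmAt (toSite r) Lc (KInvStep (d := d) Lc j)) yz.1 yz.2 (Sum.inl α) f *
          ∑' w : Site (d + 1), (if w β % (Lc : ℤ) = (Lc : ℤ) - 1 then (1 : ℝ) else 0) * ((stepScale d Lc j * (Lc : ℝ) ^ (d + 1))⁻¹ *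
            ∑' t : Site (d + 1), (if t κ' % (Lc : ℤ) = (Lc : ℤ) - 1 then SpureRecAt d Lc (toSite r) cE cVH cΛ j κ' t yz.2 w f (Sum.inl β) else 0)) else 0)
      = (stepScale d Lc j * (Lc : ℝ) ^ (d + 1))⁻¹ * (stepScale d Lc j * (Lc : ℝ) ^ (d + 1))⁻¹ *
        ∑ rr ∈ box (d + 1) Lc, ∑' t : Site (d + 1),
          (if toSite rr κ % (Lc : ℤ) = (Lc : ℤ) - 1 then (1 : ℝ) else 0) * (if t κ' % (Lc : ℤ) = (Lc : ℤ) - 1 then (1 : ℝ) else 0) *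
            ∑' yw : Site (d + 1) × Site (d + 1), (if yw.1 α % (Lc : ℤ) = (Lc : ℤ) - 1 then (1 : ℝ) else 0) * (if yw.2 β % (Lc : ℤ) = (Lc : ℤ) - 1 then (1 : ℝ) else 0) *
              comp (comp (SpureRecAt d Lc (toSite r) cE cVH cΛ j κ (toSite rr)) (coDressKBmAt (toSite r) Lc (KInvStep (d := d) Lc j)))
                (SpureRecAt d Lc (toSite r) cE cVH cΛ j κ' t) yw.1 yw.2 (Sum.inl α) (Sum.inl β) := by
  obtain ⟨δ, CG, Cs, hδ, hCG, hG, hS⟩ := decays_locStencil_common (d := d) hLc hr cE cVH cΛ j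
  -- the inner `if … then S … else 0` as a mask product
  have e0 : ∀ (z w : Site (d + 1)) (f : Fib d),
      (∑' t : Site (d + 1), (if t κ' % (Lc : ℤ) = (Lc : ℤ) - 1 then SpureRecAt d Lc (toSite r) cE cVH cΛ j κ' t z w f (Sum.inl β) else 0))
        = ∑' t : Site (d + 1), (if t κ' % (Lc : ℤ) = (Lc : ℤ) - 1 then (1 : ℝ) else 0) * SpureRecAt d Lc (toSite r) cE cVH cΛ j κ' t z w f (Sum.inl β) :=
    fun z w f => tsum_congr fun t => by split_ifs <;> simp
  simp_rw [e0]
  -- the bridge per first bond `toSite rr`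
  have hN := fun rr : Fin (d + 1) → ℕ =>
    nested_eq_facePairing hS hG hδ (Lc : ℤ) κ κ' α β (toSite rr) ((stepScale d Lc j * (Lc : ℝ) ^ (d + 1))⁻¹)
  -- distribute the outer constant, swap the two finite sums, and close per first bond
  simp_rw [Finset.mul_sum]
  rw [Finset.sum_comm]
  refine Finset.sum_congr rfl fun rr _ => ?_
  rw [← Finset.mul_sum, sum_ite_const_eq_mask_mul, hN rr]
  simp only [← tsum_mul_left]
  exact tsum_congr fun t => tsum_congr fun yw => by ring

/-- NOT IN PRINT; OUR BOOKKEEPING.  **… AND EQUALLY `cH_j²·Σ_{rr∈box} Σ'_v Ψ(v, toSite rr)` — THE CELL ON THE `κ′`-CURRENT** (§3 `sum_box_tsum_facePairing_swap`):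
Part 40's first contact summand with the cell restriction of road-P2's `zmode` moved from the `κ`-current (as displayed) onto the `κ′`-current. -/
theorem contactA_eq_facePairing_swap (hLc : 1 ≤ Lc) (hr : r ∈ box (d + 1) Lc) (cE cVH cΛ : ℝ) (j : ℕ) (κ κ' α β : Fin (d + 1)) :
    ∑ f : Fib d, (stepScale d Lc j * (Lc : ℝ) ^ (d + 1))⁻¹ * ∑ rr ∈ box (d + 1) Lc, (if toSite rr κ % (Lc : ℤ) = (Lc : ℤ) - 1 then
        ∑' yz : Site (d + 1) × Site (d + 1), (if yz.1 α % (Lc : ℤ) = (Lc : ℤ) - 1 then (1 : ℝ) else 0) *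
          comp (SpureRecAt d Lc (toSite r) cE cVH cΛ j κ (toSite rr)) (coDressKBmAt (toSite r) Lc (KInvStep (d := d) Lc j)) yz.1 yz.2 (Sum.inl α) f *
          ∑' w : Site (d + 1), (if w β % (Lc : ℤ) = (Lc : ℤ) - 1 then (1 : ℝ) else 0) * ((stepScale d Lc j * (Lc : ℝ) ^ (d + 1))⁻¹ *
            ∑' t : Site (d + 1), (if t κ' % (Lc : ℤ) = (Lc : ℤ) - 1 then SpureRecAt d Lc (toSite r) cE cVH cΛ j κ' t yz.2 w f (Sum.inl β) else 0)) else 0)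
      = (stepScale d Lc j * (Lc : ℝ) ^ (d + 1))⁻¹ * (stepScale d Lc j * (Lc : ℝ) ^ (d + 1))⁻¹ *
        ∑ rr ∈ box (d + 1) Lc, ∑' v : Site (d + 1),
          (if v κ % (Lc : ℤ) = (Lc : ℤ) - 1 then (1 : ℝ) else 0) * (if toSite rr κ' % (Lc : ℤ) = (Lc : ℤ) - 1 then (1 : ℝ) else 0) *
            ∑' yw : Site (d + 1) × Site (d + 1), (if yw.1 α % (Lc : ℤ) = (Lc : ℤ) - 1 then (1 : ℝ) else 0) * (if yw.2 β % (Lc : ℤ) = (Lc : ℤ) - 1 then (1 : ℝ) else 0) *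
              comp (comp (SpureRecAt d Lc (toSite r) cE cVH cΛ j κ v) (coDressKBmAt (toSite r) Lc (KInvStep (d := d) Lc j)))
                (SpureRecAt d Lc (toSite r) cE cVH cΛ j κ' (toSite rr)) yw.1 yw.2 (Sum.inl α) (Sum.inl β) := by
  rw [contactA_eq_facePairing hLc hr cE cVH cΛ j κ κ' α β, sum_box_tsum_facePairing_swap hLc hr cE cVH cΛ j κ κ' α β]

end WallBridge

/-! ## §4 The second contact summand (`G_j ∘ S_j κ rr` against the left-leg current): the same pairing with `κ ↔ κ′`, via the transposed data -/

section SecondWord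

variable {S : Fin (d + 1) → Site (d + 1) → MKer (d + 1) (Fib d)} {G : MKer (d + 1) (Fib d)} {Cs CG δ : ℝ}

/-- [folklore] The transposed stencil family is a local stencil family with the same data. -/
theorem locStencil_trK (hS : LocStencil S Cs δ) : LocStencil (fun κ u => trK (S κ u)) Cs δ := fun κ u => biLoc_trK (hS κ u)

/-- NOT IN PRINT; OUR BOOKKEEPING.  **THE BRIDGE FOR THE SECOND WORD** (local stencil family `S`, decaying `G`, common rate `δ > 0`; first bond `v`; any scalar
`c`): `Σ_f Σ'_{(w,z)} 𝟙[w_β]·(G ∘ S κ v)(z,w)(f,inl β)·Σ'_y 𝟙[y_α]·(c·Σ'_t 𝟙[t_κ′]·S κ′ t (y,z)(inl α,f)) = c·Σ'_t 𝟙[t_κ′]·Σ'_{(y,w)} 𝟙[y_α]𝟙[w_β]·(S κ′ t ∘ (G ∘ S κ v))(y,w)(inl α, inl β)`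
— Part 42's `nested_eq_facePairing` on the TRANSPOSED data (`trK (S κ u)`, `trK G`, legs `β, α`), `trK_comp` to return, the leg pair re-indexed by the swap. -/
theorem nested_eq_facePairing_snd (hS : LocStencil S Cs δ) (hG : Decays G CG δ) (hδ : 0 < δ) (N : ℤ) (κ κ' α β : Fin (d + 1)) (v : Site (d + 1)) (c : ℝ) :
    ∑ f : Fib d, ∑' wz : Site (d + 1) × Site (d + 1), (if wz.1 β % N = N - 1 then (1 : ℝ) else 0) * comp G (S κ v) wz.2 wz.1 f (Sum.inl β) *
        ∑' y : Site (d + 1), (if y α % N = N - 1 then (1 : ℝ) else 0) *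
          (c * ∑' t : Site (d + 1), (if t κ' % N = N - 1 then (1 : ℝ) else 0) * S κ' t y wz.2 (Sum.inl α) f)
      = c * ∑' t : Site (d + 1), (if t κ' % N = N - 1 then (1 : ℝ) else 0) *
          ∑' yw : Site (d + 1) × Site (d + 1), (if yw.1 α % N = N - 1 then (1 : ℝ) else 0) * (if yw.2 β % N = N - 1 then (1 : ℝ) else 0) *
            comp (S κ' t) (comp G (S κ v)) yw.1 yw.2 (Sum.inl α) (Sum.inl β) := by
  have hT := nested_eq_facePairing (S := fun κ u => trK (S κ u)) (G := trK G) (locStencil_trK hS) (decays_trK hG) hδ N κ κ' β α v c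
  -- the transposed words, read back
  have e1 : ∀ (w z : Site (d + 1)) (f : Fib d), comp (trK (S κ v)) (trK G) w z (Sum.inl β) f = comp G (S κ v) z w f (Sum.inl β) := by
    intro w z f
    rw [← trK_comp]; rfl
  have e2 : ∀ (t : Site (d + 1)) (w y : Site (d + 1)), comp (comp (trK (S κ v)) (trK G)) (trK (S κ' t)) w y (Sum.inl β) (Sum.inl α)
      = comp (S κ' t) (comp G (S κ v)) y w (Sum.inl α) (Sum.inl β) := by
    intro t w y
    rw [← trK_comp, ← trK_comp]; rfl
  simp only [trK_apply, e1] at hT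
  rw [hT]
  congr 1
  refine tsum_congr fun t => ?_
  congr 1
  rw [← (Equiv.prodComm (Site (d + 1)) (Site (d + 1))).tsum_eq]
  refine tsum_congr fun yw => ?_
  simp only [Equiv.prodComm_apply, Prod.fst_swap, Prod.snd_swap]
  rw [e2]
  ring

end SecondWord

section WallSecond

variable {Lc : ℕ} [NeZero Lc] {r : Fin (d + 1) → ℕ}

/-- NOT IN PRINT; OUR BOOKKEEPING.  **PART 40's SECOND CONTACT SUMMAND IS `cH_j²·Σ_{rr∈box} Σ'_t Ψ′(toSite rr, t)`**, `Ψ′(v,t) := 𝟙[v_κ]·𝟙[t_κ′]·Σ'_{(y,w)} 𝟙[y_α]𝟙[w_β]·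
(S_j κ′ t ∘ (G_j ∘ S_j κ v))(y,w)(inl α, inl β)` (the literal bracket of `QuarticMemberTwoLevel.zmode_T2RecAt_succ_twoLevel(′)` :68–:72 ∕ Part 38, cell on the
`κ`-current as displayed; every `j`, in-block root, `1 ≤ Lc`, ANY colour constants). -/
theorem contactB_eq_facePairing (hLc : 1 ≤ Lc) (hr : r ∈ box (d + 1) Lc) (cE cVH cΛ : ℝ) (j : ℕ) (κ κ' α β : Fin (d + 1)) :
    ∑ f : Fib d, (stepScale d Lc j * (Lc : ℝ) ^ (d + 1))⁻¹ * ∑ rr ∈ box (d + 1) Lc, (if toSite rr κ % (Lc : ℤ) = (Lc : ℤ) - 1 then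
        ∑' wz : Site (d + 1) × Site (d + 1), (if wz.1 β % (Lc : ℤ) = (Lc : ℤ) - 1 then (1 : ℝ) else 0) *
          comp (coDressKBmAt (toSite r) Lc (KInvStep (d := d) Lc j)) (SpureRecAt d Lc (toSite r) cE cVH cΛ j κ (toSite rr)) wz.2 wz.1 f (Sum.inl β) *
          ∑' y : Site (d + 1), (if y α % (Lc : ℤ) = (Lc : ℤ) - 1 then (1 : ℝ) else 0) * ((stepScale d Lc j * (Lc : ℝ) ^ (d + 1))⁻¹ *
            ∑' t : Site (d + 1), (if t κ' % (Lc : ℤ) = (Lc : ℤ) - 1 then SpureRecAt d Lc (toSite r) cE cVH cΛ j κ' t y wz.2 (Sum.inl α) f else 0)) else 0)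
      = (stepScale d Lc j * (Lc : ℝ) ^ (d + 1))⁻¹ * (stepScale d Lc j * (Lc : ℝ) ^ (d + 1))⁻¹ *
        ∑ rr ∈ box (d + 1) Lc, ∑' t : Site (d + 1),
          (if toSite rr κ % (Lc : ℤ) = (Lc : ℤ) - 1 then (1 : ℝ) else 0) * (if t κ' % (Lc : ℤ) = (Lc : ℤ) - 1 then (1 : ℝ) else 0) *
            ∑' yw : Site (d + 1) × Site (d + 1), (if yw.1 α % (Lc : ℤ) = (Lc : ℤ) - 1 then (1 : ℝ) else 0) * (if yw.2 β % (Lc : ℤ) = (Lc : ℤ) - 1 then (1 : ℝ) else 0) *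
              comp (SpureRecAt d Lc (toSite r) cE cVH cΛ j κ' t)
                (comp (coDressKBmAt (toSite r) Lc (KInvStep (d := d) Lc j)) (SpureRecAt d Lc (toSite r) cE cVH cΛ j κ (toSite rr))) yw.1 yw.2 (Sum.inl α) (Sum.inl β) := by
  obtain ⟨δ, CG, Cs, hδ, hCG, hG, hS⟩ := decays_locStencil_common (d := d) hLc hr cE cVH cΛ j
  have e0 : ∀ (y z : Site (d + 1)) (f : Fib d),
      (∑' t : Site (d + 1), (if t κ' % (Lc : ℤ) = (Lc : ℤ) - 1 then SpureRecAt d Lc (toSite r) cE cVH cΛ j κ' t y z (Sum.inl α) f else 0))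
        = ∑' t : Site (d + 1), (if t κ' % (Lc : ℤ) = (Lc : ℤ) - 1 then (1 : ℝ) else 0) * SpureRecAt d Lc (toSite r) cE cVH cΛ j κ' t y z (Sum.inl α) f :=
    fun y z f => tsum_congr fun t => by split_ifs <;> simp
  simp_rw [e0]
  have hN := fun rr : Fin (d + 1) → ℕ =>
    nested_eq_facePairing_snd hS hG hδ (Lc : ℤ) κ κ' α β (toSite rr) ((stepScale d Lc j * (Lc : ℝ) ^ (d + 1))⁻¹)
  simp_rw [Finset.mul_sum]
  rw [Finset.sum_comm]
  refine Finset.sum_congr rfl fun rr _ => ?_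
  rw [← Finset.mul_sum, sum_ite_const_eq_mask_mul, hN rr]
  simp only [← tsum_mul_left]
  exact tsum_congr fun t => tsum_congr fun yw => by ring

end WallSecond

/-! ## §5 The second word's cell restriction also moves (`S_j κ′ t ∘ (G_j ∘ S_j κ v)`: bi-localised at `(t, v)`, jointly block-covariant) -/

section SecondSwap

variable {S : Fin (d + 1) → Site (d + 1) → MKer (d + 1) (Fib d)} {G : MKer (d + 1) (Fib d)} {Cs CG δ : ℝ}

/-- [folklore] **THE SECOND TRIPLE WORD IS BI-LOCALISED AT ITS TWO BONDS, SMALL IN THEIR DISTANCE** (`biLoc_comp_decays` then `biLoc_comp_biLoc`). -/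
theorem biLoc_tripleWord_snd (hS : LocStencil S Cs δ) (hG : Decays G CG δ) (hδ : 0 < δ) (κ κ' : Fin (d + 1)) (v t : Site (d + 1)) :
    BiLoc (comp (S κ' t) (comp G (S κ v))) t v
      ((Fintype.card (Fib d) : ℝ) * (Cs * ((Fintype.card (Fib d) : ℝ) * (CG * Cs) * Zl (d + 1) (δ - δ / 2))) * Zl (d + 1) (δ / 2 / 2)
        * Real.exp (-(δ / 2 / 2) * l1 (t - v))) (δ / 2) := by
  have hCs : 0 ≤ Cs := (hS κ v).nonneg (Sum.inl 0)
  have h1 : BiLoc (comp G (S κ v)) v v ((Fintype.card (Fib d) : ℝ) * (CG * Cs) * Zl (d + 1) (δ - δ / 2)) (δ / 2) :=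
    biLoc_comp_decays hG (hS κ v) (by positivity) (by linarith)
  have h2 : BiLoc (S κ' t) t t Cs (δ / 2) := biLoc_mono (hS κ' t) hCs (by linarith)
  exact biLoc_comp_biLoc h2 h1 (by positivity)

/-- [folklore] **JOINT BLOCK COVARIANCE OF THE SECOND TRIPLE WORD**. -/
theorem tripleWord_snd_translate {N : ℕ} (hSt : ∀ κ u t, S κ (u + (N : ℤ) • t) = shiftK (-((N : ℤ) • t)) (S κ u))
    (hGt : ∀ t, shiftK (-((N : ℤ) • t)) G = G) (κ κ' : Fin (d + 1)) (v s t : Site (d + 1)) :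
    comp (S κ' (s + (N : ℤ) • t)) (comp G (S κ (v + (N : ℤ) • t))) = shiftK (-((N : ℤ) • t)) (comp (S κ' s) (comp G (S κ v))) := by
  rw [hSt κ v t, hSt κ' s t]
  conv_lhs => rw [← hGt t]
  rw [comp_shiftK, comp_shiftK]

end SecondSwap

section WallSecondSwap

variable {Lc : ℕ} [NeZero Lc] {r : Fin (d + 1) → ℕ}

/-- NOT IN PRINT; OUR BOOKKEEPING.  **THE SECOND PAIRING's CELL RESTRICTION SITS ON EITHER CURRENT**: with `Ψ′(v,t)` as in `contactB_eq_facePairing`,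
`Σ_{rr ∈ box} Σ'_t Ψ′(toSite rr, t) = Σ_{rr ∈ box} Σ'_v Ψ′(v, toSite rr)` (Part 42 `sum_box_tsum_swap_of_cov` on `Ψ′`). -/
theorem sum_box_tsum_facePairing_snd_swap (hLc : 1 ≤ Lc) (hr : r ∈ box (d + 1) Lc) (cE cVH cΛ : ℝ) (j : ℕ) (κ κ' α β : Fin (d + 1)) :
    ∑ rr ∈ box (d + 1) Lc, ∑' t : Site (d + 1),
        (if toSite rr κ % (Lc : ℤ) = (Lc : ℤ) - 1 then (1 : ℝ) else 0) * (if t κ' % (Lc : ℤ) = (Lc : ℤ) - 1 then (1 : ℝ) else 0) *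
          ∑' yw : Site (d + 1) × Site (d + 1), (if yw.1 α % (Lc : ℤ) = (Lc : ℤ) - 1 then (1 : ℝ) else 0) * (if yw.2 β % (Lc : ℤ) = (Lc : ℤ) - 1 then (1 : ℝ) else 0) *
            comp (SpureRecAt d Lc (toSite r) cE cVH cΛ j κ' t)
              (comp (coDressKBmAt (toSite r) Lc (KInvStep (d := d) Lc j)) (SpureRecAt d Lc (toSite r) cE cVH cΛ j κ (toSite rr))) yw.1 yw.2 (Sum.inl α) (Sum.inl β)
      = ∑ rr ∈ box (d + 1) Lc, ∑' v : Site (d + 1),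
        (if v κ % (Lc : ℤ) = (Lc : ℤ) - 1 then (1 : ℝ) else 0) * (if toSite rr κ' % (Lc : ℤ) = (Lc : ℤ) - 1 then (1 : ℝ) else 0) *
          ∑' yw : Site (d + 1) × Site (d + 1), (if yw.1 α % (Lc : ℤ) = (Lc : ℤ) - 1 then (1 : ℝ) else 0) * (if yw.2 β % (Lc : ℤ) = (Lc : ℤ) - 1 then (1 : ℝ) else 0) *
            comp (SpureRecAt d Lc (toSite r) cE cVH cΛ j κ' (toSite rr))
              (comp (coDressKBmAt (toSite r) Lc (KInvStep (d := d) Lc j)) (SpureRecAt d Lc (toSite r) cE cVH cΛ j κ v)) yw.1 yw.2 (Sum.inl α) (Sum.inl β) := by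
  obtain ⟨δ, CG, Cs, hδ, hCG, hG, hS⟩ := decays_locStencil_common (d := d) hLc hr cE cVH cΛ j
  set Ψ : Site (d + 1) → Site (d + 1) → ℝ := fun v t =>
    (if v κ % (Lc : ℤ) = (Lc : ℤ) - 1 then (1 : ℝ) else 0) * (if t κ' % (Lc : ℤ) = (Lc : ℤ) - 1 then (1 : ℝ) else 0) *
      ∑' yw : Site (d + 1) × Site (d + 1), (if yw.1 α % (Lc : ℤ) = (Lc : ℤ) - 1 then (1 : ℝ) else 0) * (if yw.2 β % (Lc : ℤ) = (Lc : ℤ) - 1 then (1 : ℝ) else 0) *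
        comp (SpureRecAt d Lc (toSite r) cE cVH cΛ j κ' t)
          (comp (coDressKBmAt (toSite r) Lc (KInvStep (d := d) Lc j)) (SpureRecAt d Lc (toSite r) cE cVH cΛ j κ v)) yw.1 yw.2 (Sum.inl α) (Sum.inl β) with hΨ
  set K₀ : ℝ := (Fintype.card (Fib d) : ℝ) * (Cs * ((Fintype.card (Fib d) : ℝ) * (CG * Cs) * Zl (d + 1) (δ - δ / 2))) * Zl (d + 1) (δ / 2 / 2) with hK₀
  have hbound : ∀ v t, |Ψ v t| ≤ K₀ * (Zl (d + 1) (δ / 2) * Zl (d + 1) (δ / 2)) * Real.exp (-(δ / 2 / 2) * l1 (t - v)) := by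
    intro v t
    have hW := biLoc_tripleWord_snd hS hG hδ κ κ' v t
    have h := abs_tsum_facePair_le hW (by positivity) (Lc : ℤ) α β (Sum.inl α) (Sum.inl β)
    have h0 : 0 ≤ K₀ * Real.exp (-(δ / 2 / 2) * l1 (t - v)) * (Zl (d + 1) (δ / 2) * Zl (d + 1) (δ / 2)) := (abs_nonneg _).trans h
    simp only [hΨ]
    rw [abs_mul, abs_mul]
    calc |(if v κ % (Lc : ℤ) = (Lc : ℤ) - 1 then (1 : ℝ) else 0)| * |(if t κ' % (Lc : ℤ) = (Lc : ℤ) - 1 then (1 : ℝ) else 0)| * _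
        ≤ 1 * 1 * (K₀ * Real.exp (-(δ / 2 / 2) * l1 (t - v)) * (Zl (d + 1) (δ / 2) * Zl (d + 1) (δ / 2))) :=
          mul_le_mul (mul_le_mul (abs_faceMask_le _ v κ) (abs_faceMask_le _ t κ') (abs_nonneg _) zero_le_one) h (abs_nonneg _) (by norm_num)
      _ = K₀ * (Zl (d + 1) (δ / 2) * Zl (d + 1) (δ / 2)) * Real.exp (-(δ / 2 / 2) * l1 (t - v)) := by ring
  have hδ4 : 0 < δ / 2 / 2 := by positivity
  have hGs : ∀ v, Summable fun t => Ψ v t := fun v =>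
    Summable.of_norm_bounded ((summable_exp_shift' hδ4 v).mul_left (K₀ * (Zl (d + 1) (δ / 2) * Zl (d + 1) (δ / 2))))
      (fun t => by rw [Real.norm_eq_abs]; exact hbound v t)
  have hGv : ∀ t, Summable fun v => Ψ v t := fun t =>
    Summable.of_norm_bounded ((summable_exp_shift hδ4 t).mul_left (K₀ * (Zl (d + 1) (δ / 2) * Zl (d + 1) (δ / 2))))
      (fun v => by rw [Real.norm_eq_abs]; exact hbound v t)
  have hGcov : ∀ v t w : Site (d + 1), Ψ (v + (Lc : ℤ) • w) (t + (Lc : ℤ) • w) = Ψ v t := by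
    intro v t w
    simp only [hΨ]
    rw [faceMask_add_zsmul Lc v w κ, faceMask_add_zsmul Lc t w κ',
      tripleWord_snd_translate (S := SpureRecAt d Lc (toSite r) cE cVH cΛ j) (G := coDressKBmAt (toSite r) Lc (KInvStep (d := d) Lc j))
        (fun κ u t => SpureRecAt_translate (toSite r) hLc cE cVH cΛ j κ u t) (fun t => shiftK_coDressKBmAt_KInvStep (d := d) (toSite r) j t)
        κ κ' v t w,
      tsum_facePair_shiftK Lc _ w α β (Sum.inl α) (Sum.inl β)]
  exact (sum_box_tsum_swap_of_cov (N := Lc) hGs hGv hGcov).symm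

/-- NOT IN PRINT; OUR BOOKKEEPING.  **PART 40's SECOND CONTACT SUMMAND WITH THE CELL ON THE `κ′`-CURRENT**: `= cH_j²·Σ_{rr∈box} Σ'_v Ψ′(v, toSite rr)`. -/
theorem contactB_eq_facePairing_swap (hLc : 1 ≤ Lc) (hr : r ∈ box (d + 1) Lc) (cE cVH cΛ : ℝ) (j : ℕ) (κ κ' α β : Fin (d + 1)) :
    ∑ f : Fib d, (stepScale d Lc j * (Lc : ℝ) ^ (d + 1))⁻¹ * ∑ rr ∈ box (d + 1) Lc, (if toSite rr κ % (Lc : ℤ) = (Lc : ℤ) - 1 then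
        ∑' wz : Site (d + 1) × Site (d + 1), (if wz.1 β % (Lc : ℤ) = (Lc : ℤ) - 1 then (1 : ℝ) else 0) *
          comp (coDressKBmAt (toSite r) Lc (KInvStep (d := d) Lc j)) (SpureRecAt d Lc (toSite r) cE cVH cΛ j κ (toSite rr)) wz.2 wz.1 f (Sum.inl β) *
          ∑' y : Site (d + 1), (if y α % (Lc : ℤ) = (Lc : ℤ) - 1 then (1 : ℝ) else 0) * ((stepScale d Lc j * (Lc : ℝ) ^ (d + 1))⁻¹ *
            ∑' t : Site (d + 1), (if t κ' % (Lc : ℤ) = (Lc : ℤ) - 1 then SpureRecAt d Lc (toSite r) cE cVH cΛ j κ' t y wz.2 (Sum.inl α) f else 0)) else 0)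
      = (stepScale d Lc j * (Lc : ℝ) ^ (d + 1))⁻¹ * (stepScale d Lc j * (Lc : ℝ) ^ (d + 1))⁻¹ *
        ∑ rr ∈ box (d + 1) Lc, ∑' v : Site (d + 1),
          (if v κ % (Lc : ℤ) = (Lc : ℤ) - 1 then (1 : ℝ) else 0) * (if toSite rr κ' % (Lc : ℤ) = (Lc : ℤ) - 1 then (1 : ℝ) else 0) *
            ∑' yw : Site (d + 1) × Site (d + 1), (if yw.1 α % (Lc : ℤ) = (Lc : ℤ) - 1 then (1 : ℝ) else 0) * (if yw.2 β % (Lc : ℤ) = (Lc : ℤ) - 1 then (1 : ℝ) else 0) *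
              comp (SpureRecAt d Lc (toSite r) cE cVH cΛ j κ' (toSite rr))
                (comp (coDressKBmAt (toSite r) Lc (KInvStep (d := d) Lc j)) (SpureRecAt d Lc (toSite r) cE cVH cΛ j κ v)) yw.1 yw.2 (Sum.inl α) (Sum.inl β) := by
  rw [contactB_eq_facePairing hLc hr cE cVH cΛ j κ κ' α β, sum_box_tsum_facePairing_snd_swap hLc hr cE cVH cΛ j κ κ' α β]

end WallSecondSwap

end Summit.QuantumFields.BalabanUV.Beta.GAN24.ContactPairingCellTransfer

end
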